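import Literature.MathematicalPhysics.QuantumFieldTheory.ConformalBootstrap3D.PointKernelK34L505Data
import Literature.MathematicalPhysics.QuantumFieldTheory.ConformalBootstrap3D.PointKernelK34L505Segs
import Literature.MathematicalPhysics.QuantumFieldTheory.ConformalBootstrap3D.PointKernelParts

/-!
# K34L505 certificate, kernel part file P45: one-cell head segments 107, 108 in level ranges

The head cells whose kernel evaluation exceeds one `decide` are one-cell segments of `hsegsK34L505`; each is
checked by `PCert.hPartSideOK` (side conditions) and `PCert.hPartOK` per level range `[n_lo, n_lo + count)`
against an integer claim, the claims summing to `≥ 0` (`PointKernel.partsOK`); soundness is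
`PCert.hParts_sound` (`PointKernelParts`).  The part files are mutually independent (each imports only
the data file); the ranges of one cell may span several of them, and the per-cell conclusions
`hparts_i` / `hcell_i` of those cells are assembled in `PointKernelK34L505.lean`.
Estimated kernel time 242 s.
-/

set_option maxRecDepth 100000
set_option maxHeartbeats 0

namespace Literature.MathematicalPhysics.QuantumFieldTheory.ConformalBootstrap3D.PointKernelK34L505

open Literature.MathematicalPhysics.QuantumFieldTheory.ConformalBootstrap3D.PointKernel

/-- levels `[52, 57)` of segment 107: partial lower sum `≥` claim. [folklore] -/
theorem part_107_3 : certK34L505.hPartOK (PCert.segAt hsegsK34L505 107) JHK34L505 52 5 (661480296902786640098743463986038913) = true := by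
  decide +kernel

/-- one-cell segment 108 (row 6, cell `[897/128, 3589/512]`, chord, `n_F = 64`,
6 level ranges): side conditions. [folklore] -/
theorem pside_108 : certK34L505.hPartSideOK (PCert.segAt hsegsK34L505 108) JHK34L505 = true := by
  decide +kernel

/-- its level ranges `(n_lo, count, claim)`. [folklore] -/
def partsK34L505_108 : List (ℕ × ℕ × ℤ) := [(0, 28, -21166240985170330758202909995806584042), (28, 12, 15163558914642230777612214056270874950), (40, 9, 4065913763566401866495556308422135414), (49, 7, 1287362321739879914418706901140841786), (56, 5, 447943688652748481846919218427079975), (61, 4, 201462296569069717829513511545651919)]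

/-- the ranges tile `[0, n_F]` and the claims sum to `≥ 0`. [folklore] -/
theorem pcov_108 : PointKernel.partsOK 64 partsK34L505_108 = true := by
  decide +kernel

/-- levels `[0, 28)` of segment 108: partial lower sum `≥` claim. [folklore] -/
theorem part_108_0 : certK34L505.hPartOK (PCert.segAt hsegsK34L505 108) JHK34L505 0 28 (-21166240985170330758202909995806584042) = true := by
  decide +kernel

/-- levels `[28, 40)` of segment 108: partial lower sum `≥` claim. [folklore] -/
theorem part_108_1 : certK34L505.hPartOK (PCert.segAt hsegsK34L505 108) JHK34L505 28 12 (15163558914642230777612214056270874950) = true := by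
  decide +kernel

/-- levels `[40, 49)` of segment 108: partial lower sum `≥` claim. [folklore] -/
theorem part_108_2 : certK34L505.hPartOK (PCert.segAt hsegsK34L505 108) JHK34L505 40 9 (4065913763566401866495556308422135414) = true := by
  decide +kernel

end Literature.MathematicalPhysics.QuantumFieldTheory.ConformalBootstrap3D.PointKernelK34L505
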